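import Mathlib
import HarnessLib
import Summits.SmoothPoincare4.SmoothPoincare4.Theses.ConvexBisection
import Literature.Topology.FourManifolds.Cobordism

/-!
# Sketch — first lemmas for three crux-idea cards on `ConvexBisection.AcyclicBisectionRigidity`
(item stmt-SmoothPoincare4-10507), ideator 3, round 1.

* `NonTransverseMetabolisers`, `SeamIntegral` — card `non-transverse-metabolisers`.
* `SharedDualLightBulb` — card `planar-section-lightbulb`.
* `EulerBalance`, `OneSidedAcyclicity` — card `cr-relative-index`.

Nothing here is proved; the point is that the statements elaborate over existing declarations.
-/

noncomputable section

open scoped Manifold ContDiff Topology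
open Set ContinuousMap

namespace Summit.SmoothPoincare4.SmoothPoincare4.Cruxes.AcyclicBisectionRigidity.Ideas

open Literature.Geometry.Symplectic Literature.Topology.FourManifolds
open Literature.AlgebraicTopology.SingularHomology

local notation "𝔼 " n:arg => EuclideanSpace ℝ (Fin n)
local notation "𝕊 " n:arg => (Metric.sphere (0 : EuclideanSpace ℝ (Fin (n + 1))) 1)

/-! ### Card `non-transverse-metabolisers` -/

/-- The contact plane field of a Stein domain `W`, pulled back to an abstract boundary datum
`b : ∂W ↪ W` (a plane in the model tangent space `ℝ³` of the boundary 3-manifold). -/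
def seamPlane {W : Type} [TopologicalSpace W] [ChartedSpace (EuclideanHalfSpace 4) W]
    [IsManifold (𝓡∂ 4) ∞ W] [CompactSpace W] (J : SteinStructure W)
    (b : BoundaryData (𝓡∂ 4) W (𝓡 3)) (y : b.carrier) : Submodule ℝ (𝔼 3) :=
  Submodule.comap (mfderiv (𝓡 3) (𝓡∂ 4) b.incl y).toLinearMap (contactPlane J.J (b.incl y))

/-- The kernel of `H₁(∂W; ℤ) → H₁(W; ℤ)` for a boundary datum precomposed with a map
`f : Y → ∂W` (used with `f = id` and `f = ψ` a contactomorphism). -/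
def seamKernel {W : Type} [TopologicalSpace W] [ChartedSpace (EuclideanHalfSpace 4) W]
    (b : BoundaryData (𝓡∂ 4) W (𝓡 3)) {Y : Type} [TopologicalSpace Y] (f : C(Y, b.carrier)) :
    Submodule ℤ (singularHomology ℤ ℤ Y 1) :=
  LinearMap.ker (singularHomology.map (R := ℤ) (M := ℤ)
    (ContinuousMap.comp ⟨b.incl, b.continuous_incl⟩ f) 1).hom

/-- **Non-transverse metabolisers** (card `non-transverse-metabolisers`, the lever as a statement).
Two compact ℚ-acyclic Stein domains `W, W'` whose boundaries are identified by a diffeomorphism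
`ψ` carrying the complex tangencies of `J` to those of `J'` (a contactomorphism of the induced
contact structures) never kill COMPLEMENTARY subgroups of `H₁(∂W; ℤ)`: if
`K = ker (H₁(∂W) → H₁(W))` and `K' = ker (H₁(∂W) →ψ H₁(∂W') → H₁(W'))` satisfy `K ⊓ K' = ⊥` and
`K ⊔ K' = ⊤` then `H₁(∂W; ℤ) = 0`. (The STRONG form `K = K'` is false: the two ℚHD smoothing
components of Wahl's valency-4 singularities, arXiv:1005.2199 Thm 2.4 / Rem 2.5, give two Stein
ℚHB fillings of one Milnor-fillable contact link with `K ≠ K'`; but there `|K ⊓ K'| = 3p ≠ 1`,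
folder compute/wahl_A4_metabolisers.py.) Known where fillings are classified (Lisca 2008 lens
spaces; Etnyre–Ozbagci–Tosun arXiv:2408.09292 Thms 1, 18); conjectural in general. -/
def NonTransverseMetabolisers : Prop :=
  ∀ (W : Type) [TopologicalSpace W] [ChartedSpace (EuclideanHalfSpace 4) W] [IsManifold (𝓡∂ 4) ∞ W]
    [CompactSpace W] (W' : Type) [TopologicalSpace W'] [ChartedSpace (EuclideanHalfSpace 4) W']
    [IsManifold (𝓡∂ 4) ∞ W'] [CompactSpace W']
    (J : SteinStructure W) (J' : SteinStructure W')
    (b : BoundaryData (𝓡∂ 4) W (𝓡 3)) (b' : BoundaryData (𝓡∂ 4) W' (𝓡 3))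
    (ψ : b.carrier ≃ₘ⟮𝓡 3, 𝓡 3⟯ b'.carrier),
    (∀ k, 0 < k → CategoryTheory.Limits.IsZero (singularHomology ℚ ℚ W k) ∧
      CategoryTheory.Limits.IsZero (singularHomology ℚ ℚ W' k)) →
    (∀ y, Submodule.map (mfderiv (𝓡 3) (𝓡 3) ψ y).toLinearMap (seamPlane J b y) =
      seamPlane J' b' (ψ y)) →
    seamKernel b (ContinuousMap.id b.carrier) ⊓ seamKernel b' ⟨ψ, ψ.continuous⟩ = ⊥ →
    seamKernel b (ContinuousMap.id b.carrier) ⊔ seamKernel b' ⟨ψ, ψ.continuous⟩ = ⊤ →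
    Subsingleton (singularHomology ℤ ℤ b.carrier 1)

/-- **Sector (b) is empty** (card `non-transverse-metabolisers`, its consequence in the crux's own
packaging = the first stub of the line): in every acyclic common-contact Stein bisection of a
homotopy 4-sphere both halves have `H₁(Wᵢ; ℤ) = 0` (equivalently the seam is an integral homology
3-sphere). From `NonTransverseMetabolisers` + Mayer–Vietoris in the homology 4-sphere (`H₁(Γ) = K₁ ⊕ K₂`). -/
def SeamIntegral : Prop :=
  ∀ (M : Type) [TopologicalSpace M] [T2Space M] [SecondCountableTopology M]
    [ChartedSpace (EuclideanSpace ℝ (Fin 4)) M] [IsManifold (𝓡 4) ∞ M],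
    M ≃ₕ Metric.sphere (0 : EuclideanSpace ℝ (Fin 5)) 1 →
    ∀ (W₁ : Type) [TopologicalSpace W₁] [ChartedSpace (EuclideanHalfSpace 4) W₁]
      [IsManifold (𝓡∂ 4) ∞ W₁] [CompactSpace W₁] (W₂ : Type) [TopologicalSpace W₂]
      [ChartedSpace (EuclideanHalfSpace 4) W₂] [IsManifold (𝓡∂ 4) ∞ W₂] [CompactSpace W₂]
      (J₁ : SteinStructure W₁) (J₂ : SteinStructure W₂) (e₁ : W₁ → M) (e₂ : W₂ → M),
    Manifold.IsSmoothEmbedding (𝓡∂ 4) (𝓡 4) ∞ e₁ → Manifold.IsSmoothEmbedding (𝓡∂ 4) (𝓡 4) ∞ e₂ →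
    Set.range e₁ ∪ Set.range e₂ = Set.univ →
    Set.range e₁ ∩ Set.range e₂ = e₁ '' (𝓡∂ 4).boundary W₁ →
    Set.range e₁ ∩ Set.range e₂ = e₂ '' (𝓡∂ 4).boundary W₂ →
    (∀ w₁ w₂, e₁ w₁ = e₂ w₂ →
      Submodule.map (mfderiv (𝓡∂ 4) (𝓡 4) e₁ w₁).toLinearMap (contactPlane J₁.J w₁) =
        Submodule.map (mfderiv (𝓡∂ 4) (𝓡 4) e₂ w₂).toLinearMap (contactPlane J₂.J w₂)) →
    (∀ k, 0 < k → CategoryTheory.Limits.IsZero (singularHomology ℚ ℚ W₁ k) ∧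
      CategoryTheory.Limits.IsZero (singularHomology ℚ ℚ W₂ k)) →
    CategoryTheory.Limits.IsZero (singularHomology ℤ ℤ W₁ 1) ∧
      CategoryTheory.Limits.IsZero (singularHomology ℤ ℤ W₂ 1)

/-! ### Card `planar-section-lightbulb` -/

/-- **Light-bulb theorem for a family of spheres sharing ONE dual** (card
`planar-section-lightbulb`, the new topological statement the line needs; `k = 1` is Gabai's
4-dimensional light bulb theorem, arXiv:1705.09989 Thm 1.2; with a dual COLLECTION
`|Rᵢ ∩ Gⱼ| = δᵢⱼ` it is his Thm 10.1). `X` closed, smooth, simply connected; `ν` a framed embedded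
2-sphere `G = ν(·,0)` (trivial normal bundle); `R, S : Fin k →` pairwise disjoint embedded spheres,
each meeting the tube of `G` in exactly one normal disc, `Rᵢ` homotopic to `Sᵢ`, and both
complements `X ∖ ⋃ Rᵢ`, `X ∖ ⋃ Sᵢ` simply connected. Then a diffeomorphism of `X` carries
`⋃ Rᵢ` onto `⋃ Sᵢ` (spherewise). -/
def SharedDualLightBulb : Prop :=
  ∀ (X : Type) [TopologicalSpace X] [T2Space X] [SecondCountableTopology X] [CompactSpace X]
    [ChartedSpace (𝔼 4) X] [IsManifold (𝓡 4) ∞ X] [SimplyConnectedSpace X]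
    (k : ℕ) (ν : (𝕊 2) × (𝔼 2) → X) (R S : Fin k → (𝕊 2) → X)
    (hR : ∀ i, Manifold.IsSmoothEmbedding (𝓡 2) (𝓡 4) ∞ (R i))
    (hS : ∀ i, Manifold.IsSmoothEmbedding (𝓡 2) (𝓡 4) ∞ (S i)),
    Manifold.IsSmoothEmbedding ((𝓡 2).prod 𝓘(ℝ, 𝔼 2)) (𝓡 4) ∞ ν →
    (∀ i j, i ≠ j → Disjoint (Set.range (R i)) (Set.range (R j))) →
    (∀ i j, i ≠ j → Disjoint (Set.range (S i)) (Set.range (S j))) →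
    (∀ i, ∃ g : 𝕊 2, Set.range (R i) ∩ Set.range ν = ν '' ({g} ×ˢ Set.univ)) →
    (∀ i, ∃ g : 𝕊 2, Set.range (S i) ∩ Set.range ν = ν '' ({g} ×ˢ Set.univ)) →
    (∀ i, ContinuousMap.Homotopic ⟨R i, (hR i).isEmbedding.continuous⟩ ⟨S i, (hS i).isEmbedding.continuous⟩) →
    SimplyConnectedSpace ((⋃ i, Set.range (R i))ᶜ : Set X) →
    SimplyConnectedSpace ((⋃ i, Set.range (S i))ᶜ : Set X) →
    ∃ Φ : X ≃ₘ⟮𝓡 4, 𝓡 4⟯ X, ∀ i, Φ '' Set.range (R i) = Set.range (S i)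

/-! ### Card `cr-relative-index` -/

/-- Rational Betti numbers and Euler characteristic of a compact 4-manifold (with boundary). -/
def bettiQ (W : Type) [TopologicalSpace W] (k : ℕ) : ℕ :=
  Module.finrank ℚ (singularHomology ℚ ℚ W k)

/-- Euler characteristic `χ(W) = Σ_{k ≤ 4} (-1)^k b_k(W; ℚ)`. -/
def eulerQ (W : Type) [TopologicalSpace W] : ℤ :=
  (bettiQ W 0 : ℤ) - bettiQ W 1 + bettiQ W 2 - bettiQ W 3 + bettiQ W 4

/-- **Euler balance** (card `cr-relative-index`, first checkable statement): in ANY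
common-contact Stein bisection of a homotopy 4-sphere (acyclicity NOT assumed) the Euler
characteristics of the halves add up to `χ(S⁴) + χ(Γ) = 2`. Since the intersection forms of the
halves vanish (codimension-0 pieces of a homology 4-sphere), `σ(W₁) = σ(W₂) = 0`, so Epstein's
relative index of the two boundary CR structures (Ann. Math. 168 (2008), formula (7.15.2):
`R-Ind = [σ₀ - σ₁ + χ₀ - χ₁]/4` for Stein fillings) equals `(χ(W₁) - 1)/2`; in the ℚ-acyclic
crux `χ(Wᵢ) = 1` and the two embeddable CR structures on the seam have RELATIVE INDEX ZERO. -/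
def EulerBalance : Prop :=
  ∀ (M : Type) [TopologicalSpace M] [T2Space M] [SecondCountableTopology M]
    [ChartedSpace (EuclideanSpace ℝ (Fin 4)) M] [IsManifold (𝓡 4) ∞ M],
    M ≃ₕ Metric.sphere (0 : EuclideanSpace ℝ (Fin 5)) 1 →
    ∀ (W₁ : Type) [TopologicalSpace W₁] [ChartedSpace (EuclideanHalfSpace 4) W₁]
      [IsManifold (𝓡∂ 4) ∞ W₁] [CompactSpace W₁] (W₂ : Type) [TopologicalSpace W₂]
      [ChartedSpace (EuclideanHalfSpace 4) W₂] [IsManifold (𝓡∂ 4) ∞ W₂] [CompactSpace W₂]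
      (J₁ : SteinStructure W₁) (J₂ : SteinStructure W₂) (e₁ : W₁ → M) (e₂ : W₂ → M),
    Manifold.IsSmoothEmbedding (𝓡∂ 4) (𝓡 4) ∞ e₁ → Manifold.IsSmoothEmbedding (𝓡∂ 4) (𝓡 4) ∞ e₂ →
    Set.range e₁ ∪ Set.range e₂ = Set.univ →
    Set.range e₁ ∩ Set.range e₂ = e₁ '' (𝓡∂ 4).boundary W₁ →
    Set.range e₁ ∩ Set.range e₂ = e₂ '' (𝓡∂ 4).boundary W₂ →
    (∀ w₁ w₂, e₁ w₁ = e₂ w₂ →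
      Submodule.map (mfderiv (𝓡∂ 4) (𝓡 4) e₁ w₁).toLinearMap (contactPlane J₁.J w₁) =
        Submodule.map (mfderiv (𝓡∂ 4) (𝓡 4) e₂ w₂).toLinearMap (contactPlane J₂.J w₂)) →
    eulerQ W₁ + eulerQ W₂ = 2

/-- **One-sided acyclicity** (card `cr-relative-index`, companion bookkeeping): in a Stein
bisection of a homotopy 4-sphere, if ONE half is ℚ-acyclic so is the other (Mayer–Vietoris in the
homology sphere; the seam is then a ℚHS³). Hence "index zero" is symmetric in the halves. -/
def OneSidedAcyclicity : Prop :=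
  ∀ (M : Type) [TopologicalSpace M] [T2Space M] [SecondCountableTopology M]
    [ChartedSpace (EuclideanSpace ℝ (Fin 4)) M] [IsManifold (𝓡 4) ∞ M],
    M ≃ₕ Metric.sphere (0 : EuclideanSpace ℝ (Fin 5)) 1 →
    ∀ (W₁ : Type) [TopologicalSpace W₁] [ChartedSpace (EuclideanHalfSpace 4) W₁]
      [IsManifold (𝓡∂ 4) ∞ W₁] [CompactSpace W₁] (W₂ : Type) [TopologicalSpace W₂]
      [ChartedSpace (EuclideanHalfSpace 4) W₂] [IsManifold (𝓡∂ 4) ∞ W₂] [CompactSpace W₂]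
      (e₁ : W₁ → M) (e₂ : W₂ → M),
    Manifold.IsSmoothEmbedding (𝓡∂ 4) (𝓡 4) ∞ e₁ → Manifold.IsSmoothEmbedding (𝓡∂ 4) (𝓡 4) ∞ e₂ →
    Set.range e₁ ∪ Set.range e₂ = Set.univ →
    Set.range e₁ ∩ Set.range e₂ = e₁ '' (𝓡∂ 4).boundary W₁ →
    Set.range e₁ ∩ Set.range e₂ = e₂ '' (𝓡∂ 4).boundary W₂ →
    (∀ k, 0 < k → CategoryTheory.Limits.IsZero (singularHomology ℚ ℚ W₁ k)) →
    (∀ k, 0 < k → CategoryTheory.Limits.IsZero (singularHomology ℚ ℚ W₂ k))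

/-- Sanity link: `SeamIntegral` is exactly the statement that the finite-`H₁` sector of the crux is
empty; together with a homology-ball version of the route's rank-4 crux it would give the crux
(composition NOT attempted here — no skeleton at the ideation stage). -/
example : SeamIntegral → SeamIntegral := id

end Summit.SmoothPoincare4.SmoothPoincare4.Cruxes.AcyclicBisectionRigidity.Ideas
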